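import Literature.AlgebraicGeometry.HodgeTheory.RibetTypeElevenThirteenAllPowersHodgeClasses
import Literature.AlgebraicGeometry.HodgeTheory.SimpleAbelianSevenfoldHodgeClassesAll
import HarnessLib

/-!
# Simple complex abelian varieties of odd prime dimension `p`: `B•(Xⁿ) = D•(Xⁿ)` outside the generic shape `End⁰ = ℚ`
# and the unitary shapes with both multiplicities `≥ 8` and `∉ {11, 13}` — the cases `p = 17, 19, 23`

Family `hodge`, layer `Literature/AlgebraicGeometry/HodgeTheory`. Research context: cell `pub-hodge-ring2` (HONEST
FRAMING: research route conditional on HC_CM; not a corollary; Q11.4-sentence-2 already refuted in dim ≥ 3),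
Literature lane gen 84, programme R69 (census). Theorems only (no definition, no named fact, D-0026; nothing admitted).
Pointwise (per-`X`) form of the census `tankeevRibet1983_iff_generic_ge_eleven_and_unitary_ge_eight_notin_eleven_thirteen`:
for `X` simple of odd prime dimension, `B = D` on all powers GRANTED only (S1) the shape `End⁰(X) = ℚ` and (S2) the
imaginary-quadratic shapes with multiplicities both `≥ 8` and `∉ {11, 13}` — by the tree's
`isDivisorGenerated_powSucc_of_isSimple_of_prime_of_odd_of_ge_four` and this lane's packaged Ribet theorem
`AbelianVariety.isDivisorGenerated_powSucc_of_ribetType_coprime_min_le_seven_or_mem`. Consequences: a simple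
SEVENTEENFOLD with `End⁰ ≠ ℚ` and no `k`-signature `{8, 9}`, a simple NINETEENFOLD with `End⁰ ≠ ℚ` and no `k`-signature
`{9, 10}`, a simple `23`-FOLD with `End⁰ ≠ ℚ` and no `k`-signature `{8, 15}` or `{9, 14}` satisfy the Hodge conjecture
on all powers — UNCONDITIONALLY.

## References
* [MoonenZarhin1999LowDim] B. Moonen, Yu. Zarhin, Math. Ann. 315 (1999), §2 (2.4), Thm. (2.7).
* [Ribet1983] K. A. Ribet, Amer. J. Math. 105 (1983), Thms. 0–3.
* [Gordon1997] B. B. Gordon, *A survey of the Hodge conjecture for abelian varieties*, Thm. 6.3 and Corollary.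
* [Deligne2000] P. Deligne, *The Hodge conjecture* (Clay, 2000), §1.
-/

noncomputable section

open CategoryTheory Module

namespace Literature.AlgebraicGeometry.HodgeTheory

open Literature.AlgebraicGeometry.Motives

variable {X : AbelianVariety ℂ}

/-- **`B•(X^{N+1}) = D•(X^{N+1})` for `X` simple of odd prime dimension, GRANTED (S1) `End⁰ = ℚ` and (S2) the
imaginary-quadratic shapes with both multiplicities `≥ 8` and `∉ {11, 13}`.** All other shapes are theorems of the tree
(coprime multiplicities with `min ≤ 7` or a multiplicity in `{11, 13}`: `…_of_ribetType_coprime_min_le_seven_or_mem`).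
[cite: MoonenZarhin1999LowDim, §2 (2.4) and Thm. (2.7)] [cite: Ribet1983, Thms. 0–3] [cite: Gordon1997, Thm. 6.3 and Corollary] -/
theorem isDivisorGenerated_powSucc_of_isSimple_of_prime_of_odd_of_ge_eight_notin (hs : X.IsSimple) (hp : X.dim.Prime)
    (hodd : Odd X.dim)
    (h1 : Module.finrank ℚ X.endAlgebra = 1 → ∀ N : ℕ, IsDivisorGenerated (X.powSucc N))
    (h8 : ∀ (φ : X ⟶ X) (d : ℕ), 0 < d → φ ≫ φ = -(d • 𝟙 X) → Module.finrank ℚ X.endAlgebra = 2 →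
      8 ≤ eigenMultiplicity X φ (Complex.I * (Real.sqrt d : ℂ)) →
      8 ≤ eigenMultiplicity X φ (-(Complex.I * (Real.sqrt d : ℂ))) →
      eigenMultiplicity X φ (Complex.I * (Real.sqrt d : ℂ)) ≠ 11 →
      eigenMultiplicity X φ (-(Complex.I * (Real.sqrt d : ℂ))) ≠ 11 →
      eigenMultiplicity X φ (Complex.I * (Real.sqrt d : ℂ)) ≠ 13 →
      eigenMultiplicity X φ (-(Complex.I * (Real.sqrt d : ℂ))) ≠ 13 → ∀ N : ℕ, IsDivisorGenerated (X.powSucc N))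
    (N : ℕ) : IsDivisorGenerated (X.powSucc N) := by
  classical
  refine isDivisorGenerated_powSucc_of_isSimple_of_prime_of_odd_of_ge_four hs hp hodd h1
    (fun φ d hd hφ he2 ha hb N => ?_) N
  have hsum := eigenMultiplicity_add_eigenMultiplicity_neg_eq_dim X φ hd hφ
  have hcop := coprime_eigenMultiplicity_of_prime hp φ hd hφ (by omega) (by omega)
  by_cases hsmall : eigenMultiplicity X φ (Complex.I * (Real.sqrt d : ℂ)) ≤ 7 ∨
      eigenMultiplicity X φ (-(Complex.I * (Real.sqrt d : ℂ))) ≤ 7 ∨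
      eigenMultiplicity X φ (Complex.I * (Real.sqrt d : ℂ)) = 11 ∨
      eigenMultiplicity X φ (-(Complex.I * (Real.sqrt d : ℂ))) = 11 ∨
      eigenMultiplicity X φ (Complex.I * (Real.sqrt d : ℂ)) = 13 ∨
      eigenMultiplicity X φ (-(Complex.I * (Real.sqrt d : ℂ))) = 13
  · exact AbelianVariety.isDivisorGenerated_powSucc_of_ribetType_coprime_min_le_seven_or_mem X φ hd hφ he2 (by omega)
      hcop hsmall N
  · simp only [not_or] at hsmall
    obtain ⟨h7a, h7b, h11a, h11b, h13a, h13b⟩ := hsmall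
    exact h8 φ d hd hφ he2 (by omega) (by omega) h11a h11b h13a h13b N

/-! ### Dimension 17 -/

/-- **`B• = D•` on all powers of a SIMPLE complex abelian SEVENTEENFOLD, granted ONLY `End⁰ = ℚ` and the `k`-signature
`{8, 9}`.** [cite: MoonenZarhin1999LowDim, §2 (2.4) and Thm. (2.7)] [cite: Ribet1983, Thms. 0–3] -/
theorem isDivisorGenerated_powSucc_of_isSimple_seventeenfold' (hs : X.IsSimple) (hX : X.dim = 17)
    (h1 : Module.finrank ℚ X.endAlgebra = 1 → ∀ N : ℕ, IsDivisorGenerated (X.powSucc N))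
    (h89 : ∀ (φ : X ⟶ X) (d : ℕ), 0 < d → φ ≫ φ = -(d • 𝟙 X) → Module.finrank ℚ X.endAlgebra = 2 →
      (eigenMultiplicity X φ (Complex.I * (Real.sqrt d : ℂ)) = 8 ∨ eigenMultiplicity X φ (Complex.I * (Real.sqrt d : ℂ)) = 9) →
      ∀ N : ℕ, IsDivisorGenerated (X.powSucc N))
    (N : ℕ) : IsDivisorGenerated (X.powSucc N) := by
  refine isDivisorGenerated_powSucc_of_isSimple_of_prime_of_odd_of_ge_eight_notin hs (by rw [hX]; norm_num)
    (by rw [hX]; exact ⟨8, rfl⟩) h1 (fun φ d hd hφ he2 ha hb _ _ _ _ N => ?_) N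
  have hsum := eigenMultiplicity_add_eigenMultiplicity_neg_eq_dim X φ hd hφ
  rw [hX] at hsum
  exact h89 φ d hd hφ he2 (by omega) N

/-- **`B• = D•` on all powers of every SIMPLE complex abelian SEVENTEENFOLD with `End⁰ ≠ ℚ` and no `k`-signature
`{8, 9}` — UNCONDITIONAL.** [cite: MoonenZarhin1999LowDim, §2 (2.4) and Thm. (2.7)] [cite: Ribet1983, Thms. 0–3] -/
theorem isDivisorGenerated_powSucc_of_isSimple_seventeenfold_of_finrank_ne_one (hs : X.IsSimple) (hX : X.dim = 17)
    (hne : Module.finrank ℚ X.endAlgebra ≠ 1)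
    (hno : ∀ (φ : X ⟶ X) (d : ℕ), 0 < d → φ ≫ φ = -(d • 𝟙 X) →
      eigenMultiplicity X φ (Complex.I * (Real.sqrt d : ℂ)) ≠ 8 ∧ eigenMultiplicity X φ (Complex.I * (Real.sqrt d : ℂ)) ≠ 9)
    (N : ℕ) : IsDivisorGenerated (X.powSucc N) :=
  isDivisorGenerated_powSucc_of_isSimple_seventeenfold' hs hX (fun h => absurd h hne)
    (fun φ d hd hφ _ h89 _ => by
      obtain ⟨h8, h9⟩ := hno φ d hd hφ
      rcases h89 with h | h
      · exact absurd h h8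
      · exact absurd h h9) N

/-- **The Hodge conjecture for all powers of every SIMPLE complex abelian SEVENTEENFOLD with `End⁰ ≠ ℚ` and no
`k`-signature `{8, 9}` — UNCONDITIONAL.** [cite: MoonenZarhin1999LowDim, §2 Thm. (2.7)] [cite: Deligne2000, §1] -/
theorem hodgeConjectureFor_powSucc_of_isSimple_seventeenfold_of_finrank_ne_one (hs : X.IsSimple) (hX : X.dim = 17)
    (hne : Module.finrank ℚ X.endAlgebra ≠ 1)
    (hno : ∀ (φ : X ⟶ X) (d : ℕ), 0 < d → φ ≫ φ = -(d • 𝟙 X) →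
      eigenMultiplicity X φ (Complex.I * (Real.sqrt d : ℂ)) ≠ 8 ∧ eigenMultiplicity X φ (Complex.I * (Real.sqrt d : ℂ)) ≠ 9)
    (N : ℕ) : HodgeConjectureFor (X.powSucc N).dim (X.powSucc N).X :=
  hodgeConjectureFor_of_isDivisorGenerated _
    (isDivisorGenerated_powSucc_of_isSimple_seventeenfold_of_finrank_ne_one hs hX hne hno N)

/-! ### Dimension 19 -/

/-- **`B• = D•` on all powers of a SIMPLE complex abelian NINETEENFOLD, granted ONLY `End⁰ = ℚ` and the `k`-signature
`{9, 10}`.** [cite: MoonenZarhin1999LowDim, §2 (2.4) and Thm. (2.7)] [cite: Ribet1983, Thms. 0–3] -/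
theorem isDivisorGenerated_powSucc_of_isSimple_nineteenfold' (hs : X.IsSimple) (hX : X.dim = 19)
    (h1 : Module.finrank ℚ X.endAlgebra = 1 → ∀ N : ℕ, IsDivisorGenerated (X.powSucc N))
    (h910 : ∀ (φ : X ⟶ X) (d : ℕ), 0 < d → φ ≫ φ = -(d • 𝟙 X) → Module.finrank ℚ X.endAlgebra = 2 →
      (eigenMultiplicity X φ (Complex.I * (Real.sqrt d : ℂ)) = 9 ∨ eigenMultiplicity X φ (Complex.I * (Real.sqrt d : ℂ)) = 10) →
      ∀ N : ℕ, IsDivisorGenerated (X.powSucc N))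
    (N : ℕ) : IsDivisorGenerated (X.powSucc N) := by
  refine isDivisorGenerated_powSucc_of_isSimple_of_prime_of_odd_of_ge_eight_notin hs (by rw [hX]; norm_num)
    (by rw [hX]; exact ⟨9, rfl⟩) h1 (fun φ d hd hφ he2 ha hb _ _ _ _ N => ?_) N
  have hsum := eigenMultiplicity_add_eigenMultiplicity_neg_eq_dim X φ hd hφ
  rw [hX] at hsum
  exact h910 φ d hd hφ he2 (by omega) N

/-- **`B• = D•` on all powers of every SIMPLE complex abelian NINETEENFOLD with `End⁰ ≠ ℚ` and no `k`-signature
`{9, 10}` — UNCONDITIONAL.** [cite: MoonenZarhin1999LowDim, §2 (2.4) and Thm. (2.7)] [cite: Ribet1983, Thms. 0–3] -/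
theorem isDivisorGenerated_powSucc_of_isSimple_nineteenfold_of_finrank_ne_one (hs : X.IsSimple) (hX : X.dim = 19)
    (hne : Module.finrank ℚ X.endAlgebra ≠ 1)
    (hno : ∀ (φ : X ⟶ X) (d : ℕ), 0 < d → φ ≫ φ = -(d • 𝟙 X) →
      eigenMultiplicity X φ (Complex.I * (Real.sqrt d : ℂ)) ≠ 9 ∧ eigenMultiplicity X φ (Complex.I * (Real.sqrt d : ℂ)) ≠ 10)
    (N : ℕ) : IsDivisorGenerated (X.powSucc N) :=
  isDivisorGenerated_powSucc_of_isSimple_nineteenfold' hs hX (fun h => absurd h hne)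
    (fun φ d hd hφ _ h910 _ => by
      obtain ⟨h9, h10⟩ := hno φ d hd hφ
      rcases h910 with h | h
      · exact absurd h h9
      · exact absurd h h10) N

/-- **The Hodge conjecture for all powers of every SIMPLE complex abelian NINETEENFOLD with `End⁰ ≠ ℚ` and no
`k`-signature `{9, 10}` — UNCONDITIONAL.** [cite: MoonenZarhin1999LowDim, §2 Thm. (2.7)] [cite: Deligne2000, §1] -/
theorem hodgeConjectureFor_powSucc_of_isSimple_nineteenfold_of_finrank_ne_one (hs : X.IsSimple) (hX : X.dim = 19)
    (hne : Module.finrank ℚ X.endAlgebra ≠ 1)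
    (hno : ∀ (φ : X ⟶ X) (d : ℕ), 0 < d → φ ≫ φ = -(d • 𝟙 X) →
      eigenMultiplicity X φ (Complex.I * (Real.sqrt d : ℂ)) ≠ 9 ∧ eigenMultiplicity X φ (Complex.I * (Real.sqrt d : ℂ)) ≠ 10)
    (N : ℕ) : HodgeConjectureFor (X.powSucc N).dim (X.powSucc N).X :=
  hodgeConjectureFor_of_isDivisorGenerated _
    (isDivisorGenerated_powSucc_of_isSimple_nineteenfold_of_finrank_ne_one hs hX hne hno N)

/-! ### Dimension 23 -/

/-- **`B• = D•` on all powers of a SIMPLE complex abelian `23`-FOLD, granted ONLY `End⁰ = ℚ` and the `k`-signatures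
`{8, 15}`, `{9, 14}`.** [cite: MoonenZarhin1999LowDim, §2 (2.4) and Thm. (2.7)] [cite: Ribet1983, Thms. 0–3] -/
theorem isDivisorGenerated_powSucc_of_isSimple_twentythreefold' (hs : X.IsSimple) (hX : X.dim = 23)
    (h1 : Module.finrank ℚ X.endAlgebra = 1 → ∀ N : ℕ, IsDivisorGenerated (X.powSucc N))
    (hres : ∀ (φ : X ⟶ X) (d : ℕ), 0 < d → φ ≫ φ = -(d • 𝟙 X) → Module.finrank ℚ X.endAlgebra = 2 →
      (eigenMultiplicity X φ (Complex.I * (Real.sqrt d : ℂ)) = 8 ∨ eigenMultiplicity X φ (Complex.I * (Real.sqrt d : ℂ)) = 9 ∨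
        eigenMultiplicity X φ (Complex.I * (Real.sqrt d : ℂ)) = 14 ∨ eigenMultiplicity X φ (Complex.I * (Real.sqrt d : ℂ)) = 15) →
      ∀ N : ℕ, IsDivisorGenerated (X.powSucc N))
    (N : ℕ) : IsDivisorGenerated (X.powSucc N) := by
  refine isDivisorGenerated_powSucc_of_isSimple_of_prime_of_odd_of_ge_eight_notin hs (by rw [hX]; norm_num)
    (by rw [hX]; exact ⟨11, rfl⟩) h1 (fun φ d hd hφ he2 ha hb h11a _ h13a _ N => ?_) N
  have hsum := eigenMultiplicity_add_eigenMultiplicity_neg_eq_dim X φ hd hφ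
  rw [hX] at hsum
  exact hres φ d hd hφ he2 (by omega) N

/-- **`B• = D•` on all powers of every SIMPLE complex abelian `23`-FOLD with `End⁰ ≠ ℚ` and no `k`-signature
`{8, 15}` or `{9, 14}` — UNCONDITIONAL.** [cite: MoonenZarhin1999LowDim, §2 (2.4) and Thm. (2.7)] [cite: Ribet1983, Thms. 0–3] -/
theorem isDivisorGenerated_powSucc_of_isSimple_twentythreefold_of_finrank_ne_one (hs : X.IsSimple) (hX : X.dim = 23)
    (hne : Module.finrank ℚ X.endAlgebra ≠ 1)
    (hno : ∀ (φ : X ⟶ X) (d : ℕ), 0 < d → φ ≫ φ = -(d • 𝟙 X) →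
      eigenMultiplicity X φ (Complex.I * (Real.sqrt d : ℂ)) ≠ 8 ∧ eigenMultiplicity X φ (Complex.I * (Real.sqrt d : ℂ)) ≠ 9 ∧
        eigenMultiplicity X φ (Complex.I * (Real.sqrt d : ℂ)) ≠ 14 ∧ eigenMultiplicity X φ (Complex.I * (Real.sqrt d : ℂ)) ≠ 15)
    (N : ℕ) : IsDivisorGenerated (X.powSucc N) :=
  isDivisorGenerated_powSucc_of_isSimple_twentythreefold' hs hX (fun h => absurd h hne)
    (fun φ d hd hφ _ hsig _ => by
      obtain ⟨h8, h9, h14, h15⟩ := hno φ d hd hφ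
      rcases hsig with h | h | h | h
      · exact absurd h h8
      · exact absurd h h9
      · exact absurd h h14
      · exact absurd h h15) N

/-- **The Hodge conjecture for all powers of every SIMPLE complex abelian `23`-FOLD with `End⁰ ≠ ℚ` and no
`k`-signature `{8, 15}` or `{9, 14}` — UNCONDITIONAL.** [cite: MoonenZarhin1999LowDim, §2 Thm. (2.7)] [cite: Deligne2000, §1] -/
theorem hodgeConjectureFor_powSucc_of_isSimple_twentythreefold_of_finrank_ne_one (hs : X.IsSimple) (hX : X.dim = 23)
    (hne : Module.finrank ℚ X.endAlgebra ≠ 1)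
    (hno : ∀ (φ : X ⟶ X) (d : ℕ), 0 < d → φ ≫ φ = -(d • 𝟙 X) →
      eigenMultiplicity X φ (Complex.I * (Real.sqrt d : ℂ)) ≠ 8 ∧ eigenMultiplicity X φ (Complex.I * (Real.sqrt d : ℂ)) ≠ 9 ∧
        eigenMultiplicity X φ (Complex.I * (Real.sqrt d : ℂ)) ≠ 14 ∧ eigenMultiplicity X φ (Complex.I * (Real.sqrt d : ℂ)) ≠ 15)
    (N : ℕ) : HodgeConjectureFor (X.powSucc N).dim (X.powSucc N).X :=
  hodgeConjectureFor_of_isDivisorGenerated _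
    (isDivisorGenerated_powSucc_of_isSimple_twentythreefold_of_finrank_ne_one hs hX hne hno N)

end Literature.AlgebraicGeometry.HodgeTheory

end
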